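import Summits.HodgeConjecture.HodgeConjecture.Theses.EndoscopicMiddleDegree
import Literature.AlgebraicGeometry.HodgeTheory.ComplexGysinCorrespondence
import Literature.AlgebraicGeometry.HodgeTheory.MotivatedClassesProofs
import HarnessLib

/-!
# Actions of algebraic correspondences preserve algebraic classes (stub `stub_corrActionAlgebraic` of line B)

Support file for the crux `IsotypicMiddleClassesAlgebraic` (item `stmt-HodgeConjecture-14301`) of
the route `Summits/HodgeConjecture/HodgeConjecture/Theses/EndoscopicMiddleDegree`, line
`IdeatorTwoSketch`. For a smooth projective `X` of dimension `2n`, `n = m + 1`, and an ALGEBRAIC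
class `γ ∈ N^{2n} H^{4n}((X ⊗ X)(ℂ); ℂ)`, the crux's correspondence action
`P a := corrAction μ hX hX rfl γ a = pr_{1*}(pr_2^* a ∪ γ)` maps `Nⁿ H^{2n}(X(ℂ); ℂ)` into itself,
GRANTED the route's support item `CupProductAlgebraic` (cup products of algebraic classes are
algebraic, Voisin II Prop. 9.20), taken by name as the hypothesis `h9`.

Proof: `corrAction μ` is the tree's `corrClassAction` for the orientations `μ_{X ⊗ X}`, `μ_X`
(`corrAction_eq_corrClassAction`, through `H_{2n}`), and `corrClassAction` of an algebraic class maps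
algebraic classes to algebraic classes granted the multiplicativity of algebraic classes on `X ⊗ X`
(`corrClassAction_mem_algebraicClasses_of_cupProduct`: flat pull-back `map_snd_mem_supportedClasses`,
the cup-product hypothesis, and the topological Gysin push-forward
`gysinMap_mem_supportedClasses_of_isSmoothProjective`), which is `h9` on the smooth projective
`X ⊗ X` (`IsSmoothProjective.tensor_holds`).
-/

noncomputable section

-- `Summit.HodgeConjecture.HodgeConjecture.Theorems` is the mandated namespace (single-problem summit),
-- flagged by `linter.dupNamespace` on every declaration.
set_option linter.dupNamespace false

open CategoryTheory MonoidalCategory CartesianMonoidalCategory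
open Literature.AlgebraicGeometry Literature.AlgebraicGeometry.Motives
open Literature.AlgebraicGeometry.HodgeTheory
open Literature.AlgebraicTopology.SingularHomology

namespace Summit.HodgeConjecture.HodgeConjecture.Theorems

/-- Degree bookkeeping for `pr_{1*} : H^{6n}((X ⊗ X)(ℂ)) → H^{2n}(X(ℂ))` through `H_{2n}(X(ℂ))`,
`n = m + 1`, `dim X = 2n`: `2n + 2n = 2 · dim X`. -/
private theorem lineB_deg_corrAction_homology (m : ℕ) :
    2 * (m + 1) + 2 * (m + 1) = 2 * (2 * (m + 1)) := by ring

/-- **Actions of algebraic correspondences preserve algebraic classes**: for an algebraic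
`γ ∈ N^{2n} H^{4n}((X ⊗ X)(ℂ))` on the smooth projective `2n`-fold `X` (`n = m + 1`), the action
`P = corrAction μ hX hX rfl γ`, `P a = pr_{1*}(pr_2^* a ∪ γ)`, maps `Nⁿ H^{2n}(X(ℂ))` into itself,
granted the route's support item `CupProductAlgebraic` on `X ⊗ X` (`corrAction_eq_corrClassAction` and
`corrClassAction_mem_algebraicClasses_of_cupProduct`: flat pull-back, cup product of algebraic
classes, Gysin push-forward). -/
theorem stub_corrActionAlgebraic (h9 : Theses.EndoscopicMiddleDegree.CupProductAlgebraic)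
    (μ : OrientationFamily) (hμ : μ.HasPoincareDuality) (m : ℕ) (X : SchemeOver ℂ)
    (hX : IsSmoothProjective (2 * (m + 1)) X)
    (γ : complexBetti (X ⊗ X) (2 * (2 * (m + 1)))) (hγ : γ ∈ algebraicClasses (X ⊗ X) (2 * (m + 1)))
    (a : complexBetti X (2 * (m + 1))) (ha : a ∈ algebraicClasses X (m + 1)) :
    corrAction μ hX hX
      (rfl : 2 * (m + 1) + 2 * (2 * (m + 1)) = 2 * (m + 1) + 2 * (2 * (m + 1))) γ a ∈
      algebraicClasses X (m + 1) := by
  rw [corrAction_eq_corrClassAction μ hX hX rfl (lineB_deg_corrAction_homology m)]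
  exact corrClassAction_mem_algebraicClasses_of_cupProduct hX hX _ _ (hμ hX) _ _
    (fun x y hx hy ↦ h9 (IsSmoothProjective.tensor_holds hX hX) _ _ x y hx hy) hγ ha

end Summit.HodgeConjecture.HodgeConjecture.Theorems

end
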